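import Summits.QuantumFields.YangMills.Theorems.HyperbolicRegulatorHyperbolicToTorus
import Literature.MathematicalPhysics.QuantumLattice.GaugeGroupsProofs
import Literature.MathematicalPhysics.QuantumFieldTheory.YangMillsOS

/-!
# `CurvatureAnchor` (stmt-QuantumFields-15826, route `HyperbolicRegulator`) — REFUTED as typed

The crux `Summit.QuantumFields.YangMills.Theses.HyperbolicRegulator.CurvatureAnchor` is
`∀ G (compact simple) r, ∃ family, H1 ∧ H2` with H1 = "the family of finite square complexes is ADMISSIBLE
(the crux's inlined `(Fam k j …).1`, named `NoAdmissibleComplex.Adm`) for ALL curvature scales `k ≥ 8` and all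
separation indices `j`". The landed theorem `NoAdmissibleComplex.no_admissible` (line `no_admissible_complex` of the
sibling crux `HyperbolicToTorus`, stmt-QuantumFields-15827) shows `208 ≤ k → ¬ Adm k j …` for ALL data: the flatness
threshold `k/4 < dist x c` equals the sup-radius `(k:ℤ)/4` of the injective `ℤ²`-charts required at flat vertices, and
double counting the first flat shell around a cone (`≤ 50` germs by axis rigidity versus `≥ k/4 − 1` by a row/column
count in one chart) is contradictory for `k ≥ 208`. Instantiating the crux at the certified compact simple Lie group
`SU(2)` (`isSimpleCompactGroup_specialUnitaryGroup_holds`, fundamental representation) and H1 at `k = 400`, `j = 0`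
refutes it.

CLASSIFICATION: `refuted-misstated`. The witness exploits only the coincidence "flat threshold = chart radius" in the
shared `Fam` vocabulary (refuter finding R3, ATTACK-15826, SKELVET; strategist STRATEGY-CENSUS); the weak-coupling
anchor H2 is never touched. Minimal repair believed true-as-intended (to be restated in LOCKSTEP in `CurvatureAnchor`,
`CurvatureUniformity`, `HyperbolicToTorus`, whose `let Fam` must stay byte-identical for `closes`):
`let F := fun x : ℕ => x ∈ V ∧ ∀ c ∈ K, k / 2 < Γ.dist x c` and
`let Dp := fun x : ℕ => x ∈ V ∧ ∀ c ∈ K, 3 * (k / 4) < Γ.dist x c`, `ib` (chart box `(k:ℤ)/4`) unchanged. The witness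
misses the repair: a chart of sup-radius `k/4` centred farther than `k/2` from every cone has graph reach `2⌊k/4⌋ ≤ k/2`
and so contains no cone, and the cone-frame / first-flat-shell objects of `no_admissible` (flat vertices at distance
EXACTLY `k/4 + 1` from a cone) no longer carry charts.
-/

namespace Summit.QuantumFields.YangMills.Theses.HyperbolicRegulator
/-- **Record of the dropped route item `CurvatureAnchor`** = stmt-QuantumFields-15826 (ledger signature verbatim; NOT a route
item): route HyperbolicRegulator (2026-08-17T13:28Z) dropped the refuted `CurvatureAnchor`. The declaration `Summit.QuantumFields.YangMills.Theses.HyperbolicRegulator.CurvatureAnchor`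
therefore no longer exists in the route file and this accepted module stopped elaborating (stale olean;
buildfix lane 2026-08-19). Re-created here under its original name so the result keeps building; the
statement of every previously accepted declaration in this file is unchanged. -/
def CurvatureAnchor : Prop :=
  open Literature.MathematicalPhysics.QuantumFieldTheory Literature.MathematicalPhysics.QuantumLattice MeasureTheory in ∀ (G : Type) [Group G] [TopologicalSpace G] [IsTopologicalGroup G] [CompactSpace G], IsCompactSimpleLieGroup G → letI : MeasurableSpace G := borel G; haveI : BorelSpace G := ⟨rfl⟩; ∀ r : LatticeRep G, let Fam := fun (k j : ℕ) (V E Q : Finset ℕ) (σ τ : ℕ → ℕ) (bd : ℕ → Fin 4 → ℕ × Bool) (cV : ℕ → ℤ × ℤ → ℕ) (cE : ℕ → ℤ × ℤ → Fin 2 → ℕ × Bool) => let st := fun e : ℕ × Bool => if e.2 then σ e.1 else τ e.1; let en := fun e : ℕ × Bool => if e.2 then τ e.1 else σ e.1; let Γ := SimpleGraph.fromRel fun a b : ℕ => ∃ e ∈ E, σ e = a ∧ τ e = b; let dg := fun x : ℕ => (E.filter fun e => σ e = x ∨ τ e = x).card; let K := V.filter fun x => dg x = 5; let F := fun x : ℕ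 => x ∈ V ∧ ∀ c ∈ K, k / 4 < Γ.dist x c; let Dp := fun x : ℕ => x ∈ V ∧ ∀ c ∈ K, k / 2 < Γ.dist x c; let ib := fun a : ℤ × ℤ => |a.1| ≤ (k : ℤ) / 4 ∧ |a.2| ≤ (k : ℤ) / 4; let nx := fun (a : ℤ × ℤ) (μ : Fin 2) => if μ = 0 then (a.1 + 1, a.2) else (a.1, a.2 + 1); let Ed := (ℕ × ℕ) ⊕ (ℕ × ℕ); let PE : Finset Ed := (E ×ˢ V).disjSum (V ×ˢ E); let Cfg := ↥PE → G; let ν := Measure.pi fun _ : ↥PE => haarProbability G; let v := fun (U : Cfg) (e : Ed × Bool) => if h : e.1 ∈ PE then (if e.2 then U ⟨e.1, h⟩ else (U ⟨e.1, h⟩)⁻¹) else 1; let w := fun (U : Cfg) (e : Fin 4 → Ed × Bool) => (r.ρ (v U (e 0) * v U (e 1) * v U (e 2) * v U (e 3))).trace.re; let S := fun U : Cfg => (∑ q ∈ Q, ∑ y ∈ V, w U fun i => (Sum.inl ((bd q i).1, y), (bd q i).2)) + (∑ y ∈ V, ∑ q ∈ Q, w U fun i => (Sum.inr (y, (bd q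 i).1), (bd q i).2)) + ∑ e ∈ E, ∑ e' ∈ E, w U ![(Sum.inl (e, σ e'), true), (Sum.inr (τ e, e'), true), (Sum.inl (e, τ e'), false), (Sum.inr (σ e, e'), false)]; let d0 : Fin 4 → Fin 2 := ![0, 1, 0, 1]; let P := fun (x x' : ℕ) (U : Cfg) (p : ZdEdge 4) => let a := (p.1 0, p.1 1); let b := (p.1 2, p.1 3); if p.2 = 0 ∨ p.2 = 1 then v U (Sum.inl ((cE x a (d0 p.2)).1, cV x' b), (cE x a (d0 p.2)).2) else v U (Sum.inr (cV x a, (cE x' b (d0 p.2)).1), (cE x' b (d0 p.2)).2); ((∀ e ∈ E, σ e ∈ V ∧ τ e ∈ V ∧ σ e ≠ τ e) ∧ (∀ q ∈ Q, (∀ i, (bd q i).1 ∈ E) ∧ (∀ i, en (bd q i) = st (bd q (i + 1))) ∧ (st ∘ bd q).Injective) ∧ (∀ e ∈ E, (Q.filter fun q => ∃ i, (bd q i).1 = e).card = 2) ∧ (∀ x ∈ V, (dg x = 4 ∨ dg x = 5) ∧ (Q.filter fun q => ∃ i, st (bd q i) = x).card = dg x) ∧ (∀ x ∈ V, ∃ c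 ∈ K, Γ.dist x c ≤ k) ∧ (∀ c ∈ K, ∀ c' ∈ K, c ≠ c' → k ≤ Γ.dist c c') ∧ (∀ f : ℕ → ℝ, ∑ x ∈ V, f x = 0 → ∑ x ∈ V, f x ^ 2 ≤ 10 ^ 6 * (k : ℝ) ^ 2 * ∑ e ∈ E, (f (σ e) - f (τ e)) ^ 2) ∧ (∃ x y, Dp x ∧ Dp y ∧ j ≤ Γ.dist x y) ∧ (∀ x, F x → cV x (0, 0) = x ∧ (∀ a, ib a → cV x a ∈ V) ∧ Set.InjOn (cV x) {a | ib a} ∧ (∀ a μ, ib a → ib (nx a μ) → (cE x a μ).1 ∈ E ∧ st (cE x a μ) = cV x a ∧ en (cE x a μ) = cV x (nx a μ)) ∧ (∀ a, ib a → ib (a.1 + 1, a.2 + 1) → ∃ q ∈ Q, Finset.univ.image (Prod.fst ∘ bd q) = {(cE x a 0).1, (cE x (nx a 0) 1).1, (cE x (nx a 1) 0).1, (cE x a 1).1})), fun (β m C : ℝ) (A B : YMSpecies G) => let X := fun f : Cfg → ℝ => (∫ U, f U * Real.exp (β * S U) ∂ν) / (∫ U, Real.exp (β * S U) ∂ν);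 ∀ x x' y y', F x → F x' → F y → F y' → |X (fun U => A.F (P x x' U) * B.F (P y y' U)) - X (fun U => A.F (P x x' U)) * X (fun U => B.F (P y y' U))| ≤ C * Real.exp (-(m * ((Γ.dist x y + Γ.dist x' y' : ℕ) : ℝ)))); let Sp := fun (A : YMSpecies G) (R : ℕ) => ∀ p ∈ A.supp, ∀ i, |p.1 i| ≤ (R : ℤ); ∃ (V E Q : ℕ → ℕ → Finset ℕ) (σ τ : ℕ → ℕ → ℕ → ℕ) (bd : ℕ → ℕ → ℕ → Fin 4 → ℕ × Bool) (cV : ℕ → ℕ → ℕ → ℤ × ℤ → ℕ) (cE : ℕ → ℕ → ℕ → ℤ × ℤ → Fin 2 → ℕ × Bool), let Φ := fun k j => Fam k j (V k j) (E k j) (Q k j) (σ k j) (τ k j) (bd k j) (cV k j) (cE k j); (∀ k j, 8 ≤ k → (Φ k j).1) ∧ (∃ c : ℝ, 0 < c ∧ ∀ k, 8 ≤ k → ∃ β₀ : ℝ, ∀ β, β₀ ≤ β → ∀ A B : YMSpecies G, Sp A (k / 8) → Sp B (k / 8) → ∃ C j₀, ∀ j, j₀ ≤ j → (Φ k j).2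 β (c / k) C A B)
end Summit.QuantumFields.YangMills.Theses.HyperbolicRegulator


set_option autoImplicit false

namespace Summit.QuantumFields.YangMills.Theorems

open Literature.MathematicalPhysics.QuantumFieldTheory Literature.MathematicalPhysics.QuantumLattice
open Summit.QuantumFields.YangMills.Cruxes.HyperbolicToTorus.NoAdmissibleComplex

/-- **`CurvatureAnchor` is false as typed** (refuted-misstated). At `G = SU(2)` with its fundamental `LatticeRep`, the
crux yields a family admissible for all `k ≥ 8` and all `j`; its admissibility at `k = 400`, `j = 0` — definitionally
`NoAdmissibleComplex.Adm 400 0 …` — contradicts `NoAdmissibleComplex.no_admissible` (no admissible complex exists at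
curvature scale `k ≥ 208`: flat threshold `k/4` = chart radius `k/4`). Repaired statement C′ (believed true as intended,
lockstep restate of the three `Fam` cruxes): flat threshold `k / 2 < Γ.dist x c`, deep threshold
`3 * (k / 4) < Γ.dist x c`, chart box `(k:ℤ)/4` unchanged; the witness misses C′ (no cone inside any chart). -/
theorem not_CurvatureAnchor : ¬ Summit.QuantumFields.YangMills.Theses.HyperbolicRegulator.CurvatureAnchor := by
  intro h
  -- `SU(2)` is a compact simple Lie group in the Statement's sense: simple by the tree's PROVED fact
  -- `isSimpleCompactGroup_specialUnitaryGroup_holds`, linear by the fundamental representation.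
  have hG : IsCompactSimpleLieGroup (Matrix.specialUnitaryGroup (Fin 2) ℂ) :=
    isCompactSimpleLieGroup_specialUnitaryGroup isSimpleCompactGroup_specialUnitaryGroup_holds le_rfl
  obtain ⟨r⟩ := hG.2
  obtain ⟨V, E, Q, σ, τ, bd, cV, cE, hAdm, -⟩ := h (Matrix.specialUnitaryGroup (Fin 2) ℂ) hG r
  have hA : Adm 400 0 (V 400 0) (E 400 0) (Q 400 0) (σ 400 0) (τ 400 0) (bd 400 0) (cV 400 0) (cE 400 0) :=
    hAdm 400 0 (by norm_num)
  exact no_admissible 400 0 _ _ _ _ _ _ _ _ (by norm_num) hA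

end Summit.QuantumFields.YangMills.Theorems
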